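import Mathlib.Analysis.Calculus.ContDiff.Deriv
import Mathlib.Analysis.Calculus.ContDiff.Operations
import Mathlib.Analysis.Calculus.Deriv.Basic
import HarnessLib

/-!
# Smoothness bootstrap for nearest-neighbour chains of ODEs

Topic `Literature/Analysis/ODE` (namespace `Literature.Analysis.ODE`). For a countable chain of
scalar equations in which mode `i` is driven by its neighbours,
`x_i'(t) = Φ_i(t, x_{i-1}(t), x_i(t), x_{i+1}(t))` (`i ∈ ℕ`; shell models of turbulence, Galerkin /
dyadic cascades), with every `Φ_i` of class `C^∞` jointly in its four arguments, every solution on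
a compact interval `[a, b]` (derivatives within `[a, b]`, Mathlib's integral-curve convention) has
ALL coordinates of class `C^∞` on `[a, b]` (one-sided at the endpoints):
`contDiffOn_of_nearestNeighbourChain`. This is the countable, nearest-neighbour instance of the
classical "solutions of `C^m` equations are `C^{m+1}` in `t`" (Hartman, *Ordinary Differential
Equations*, Ch. V §4, Cor 4.1), proved by the usual bootstrap: if all coordinates are `C^n` then
each right-hand side is `C^n`, so each coordinate is `C^{n+1}` (`contDiffOn_succ_iff_derivWithin` on
the set of unique differentiability `[a, b]`). The chain structure matters only in that each
equation sees finitely many coordinates, so no topology on `ℝ^ℕ` is needed.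

Convention: the "previous" mode of mode `0` is mode `0` itself (`x (0 - 1) = x 0` by truncated
subtraction); a chain whose first equation has no input from below simply takes `Φ 0` independent
of its second argument (as in the Obukhov / Desnyansky–Novikov models, `X_{-1} ≡ 0`).

## References

* P. Hartman, *Ordinary Differential Equations*, SIAM Classics 38 (2002), Ch. V §4, Thm 4.1 and
  Cor 4.1 (higher-order differentiability of solutions). Key `Hartman2002`.
-/

noncomputable section

open Set
open scoped ContDiff

namespace Literature.Analysis.ODE

section Chain

variable {x : ℕ → ℝ → ℝ} {Φ : ℕ → ℝ → ℝ → ℝ → ℝ → ℝ} {a b : ℝ}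

/-- **Smoothness bootstrap for a nearest-neighbour chain.** Let `Φ i : ℝ → ℝ → ℝ → ℝ → ℝ` be
`C^∞` as a function of `(t, p, q, r)` for every `i`, and let `x i : ℝ → ℝ` solve
`(x i)'(t) = Φ i t (x (i-1) t) (x i t) (x (i+1) t)` on `[a, b]`, `a < b` (derivative within
`[a, b]` at every point, the previous mode of mode `0` being mode `0`). Then every `x i` is `C^∞`
on `[a, b]`. [cite: Hartman2002, Ch. V §4 Cor 4.1] -/
theorem contDiffOn_of_nearestNeighbourChain (hab : a < b)
    (hΦ : ∀ i, ContDiff ℝ ∞ fun p : ℝ × ℝ × ℝ × ℝ => Φ i p.1 p.2.1 p.2.2.1 p.2.2.2)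
    (hx : ∀ i, ∀ t ∈ Icc a b,
      HasDerivWithinAt (x i) (Φ i t (x (i - 1) t) (x i t) (x (i + 1) t)) (Icc a b) t) (i : ℕ) :
    ContDiffOn ℝ ∞ (x i) (Icc a b) := by
  have hU : UniqueDiffOn ℝ (Icc a b) := uniqueDiffOn_Icc hab
  -- the derivative within `[a, b]`
  have hderiv : ∀ j, ∀ t ∈ Icc a b,
      derivWithin (x j) (Icc a b) t = Φ j t (x (j - 1) t) (x j t) (x (j + 1) t) :=
    fun j t ht => (hx j t ht).derivWithin (hU t ht)
  have hdiff : ∀ j, DifferentiableOn ℝ (x j) (Icc a b) :=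
    fun j t ht => (hx j t ht).differentiableWithinAt
  -- bootstrap on the (finite) order of differentiability, for all modes at once
  have key : ∀ n : ℕ, ∀ j, ContDiffOn ℝ n (x j) (Icc a b) := by
    intro n
    induction n with
    | zero =>
      intro j
      exact contDiffOn_zero.2 fun t ht => (hx j t ht).continuousWithinAt
    | succ n ih =>
      intro j
      rw [show ((n + 1 : ℕ) : ℕ∞ω) = (n : ℕ∞ω) + 1 by push_cast; rfl,
        contDiffOn_succ_iff_derivWithin hU]
      refine ⟨hdiff j, fun h => absurd h (by simp), ?_⟩
      have hrhs : ContDiffOn ℝ n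
          (fun t => Φ j t (x (j - 1) t) (x j t) (x (j + 1) t)) (Icc a b) := by
        have hg : ContDiffOn ℝ n (fun t => (t, x (j - 1) t, x j t, x (j + 1) t)) (Icc a b) :=
          contDiffOn_id.prodMk ((ih (j - 1)).prodMk ((ih j).prodMk (ih (j + 1))))
        exact ((hΦ j).of_le (by exact_mod_cast le_top)).comp_contDiffOn hg
      exact hrhs.congr fun t ht => hderiv j t ht
  exact contDiffOn_infty.2 fun n => key n i

/-- The derivative formula within `[a, b]` for a chain solution (unique differentiability of a
nondegenerate closed interval). [cite: Hartman2002, Ch. V §4 Cor 4.1] -/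
theorem derivWithin_eq_of_nearestNeighbourChain (hab : a < b)
    (hx : ∀ i, ∀ t ∈ Icc a b,
      HasDerivWithinAt (x i) (Φ i t (x (i - 1) t) (x i t) (x (i + 1) t)) (Icc a b) t)
    (i : ℕ) {t : ℝ} (ht : t ∈ Icc a b) :
    derivWithin (x i) (Icc a b) t = Φ i t (x (i - 1) t) (x i t) (x (i + 1) t) :=
  (hx i t ht).derivWithin (uniqueDiffOn_Icc hab t ht)

end Chain

end Literature.Analysis.ODE
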